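import Summits.BirchSwinnertonDyer.BirchSwinnertonDyer.Theorems.KimAtThreeDeepLowerExpStarOmegaItem
import Summits.BirchSwinnertonDyer.BirchSwinnertonDyer.Theorems.KimAtThreeDeepUpperExpStarFacts
import HarnessLib

/-!
# The registered item `DefinedKatoUniformThree` (stmt-BirchSwinnertonDyer-20013) and crux 19076 from the
# four `exp*` CITE FACTS + `nonempty_neronDeRhamDatum` + the KATO SIDE only
# (route `KimAtThreeKolyvagin` rev 14, rung W2; cell `bsd-addord`, seat w2-c3 gen 8)

HONEST FRAMING: glue with DISPLAYED hypotheses (theorems only; no definition, no named fact, no `sorry`; local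
instances as in `KimAtThreeDeepLowerExpStarOmegaPlace`); conclusions are route decls BY NAME but CONDITIONAL;
nothing is closed or booked; BSD is not proved by any of this.

w2-c2's `KimAtThreeDeepLowerExpStarOmegaBridge` / `…Item` derive the item `DefinedKatoUniformThree` (= (C1ₑₓ)) and
the five deep decls of W2 from `nonempty_neronDeRhamDatum` and the package (C1_ω) (`hω`): for every Néron line
`d`, `∃ hinj hex ιp e he ι κK Λ` with `κK ≠ 0 ∧ hker ∧ hdual ∧ X1-int_b ∧ ZetaBody`. This seat's
`KimAtThreeDeepUpperExpStarFacts.expStar_clauses_of_facts` (p508655) supplies `hinj hex ιp e he` with `hker ∧ hdual`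
from the four Literature cite facts of `PAdicHodge/DualExpElliptic` (Kato II Prop. 1.2.3 / Ex. 1.3.5, (S5a)
Bloch–Kato, (S5b) Tate duality). Hence (this file):

* `hKato` — **the KATO SIDE**, the only remaining displayed package: for every `d hinj hex ιp e he` (so for the
  functional `φ := expStarOmegaPadicAt (d.smul e he) hinj hex ιp`), `∃ ι κK Λ, κK ≠ 0 ∧ X1-int_b(Λ, φ) ∧` Kato's
  Euler system with values in `Λ` (`ZetaBody`) — i.e. (C1_ω) MINUS its `exp*`-clauses; this is Kato 2004
  (8.1.3)/Ex. 13.3/Thm. 9.7 with `Λ` DEFINED per factor ((DEF)+(RES)+(LAT), kim3 / w2-c2 / acc3–acc5 lanes),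
  displayed until the Kato-v2 typing lands;
* `expStarOmegaPackage_of_facts_of_katoSide` — **(C1_ω) = `hω` VERBATIM from the four cite facts + `hKato`**;
* item 20013 BY NAME from `nonempty_neronDeRhamDatum`, the four cite facts and `hKato` is then the term
  `definedKatoUniformThree_of_expStarOmega (expStarOmegaPackage_of_facts_of_katoSide …) hND` (w2-c2's Item file);
* `deepUpperAtThree_of_leaves_of_facts_of_katoSide` (crux 19076 BY NAME) and `kimAtThreeDeepPUB_of_leaves_of_facts_of_katoSide`
  (the whole deep leaf) from the four cite-only leaves in addition.

References: [Kato1993LNM1553] Ch. II Prop. 1.2.3, §1.2.4, Ex. 1.3.5, Thm. 1.4.1; [BlochKato1990] §3;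
[Kato2004Asterisque] (8.1.3), §9.4, Thm. 9.7, Ex. 13.3; [Kim2025RefinedTNC] Thm. 1.1; [Sakamoto2024] Thm. 4.4;
[MazurRubin2004] Thm. 5.2.12.
-/

set_option autoImplicit false
-- the Theorems namespace of a single-conjunct summit repeats the summit name by design (D-0017)
set_option linter.dupNamespace false

noncomputable section

open scoped NumberField TensorProduct ContRepresentation Classical
open CategoryTheory Field Function Finset IsDedekindDomain NumberField WeierstrassCurve
open Rat.HeightOneSpectrum
open Literature.NumberTheory.GaloisRepresentations Literature.NumberTheory.GaloisCohomology
open Literature.NumberTheory.GaloisRepresentations.DiscreteGaloisModule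
open Literature.NumberTheory.GaloisRepresentations.PeriodRingData
open Literature.NumberTheory.PAdicHodge
open Literature.NumberTheory.EllipticCurves Literature.NumberTheory.EllipticCurves.ModularForms
open Literature.NumberTheory.EllipticCurves.Rank1Residual
open Literature.NumberTheory.EllipticCurves.Kato2004
open Literature.NumberTheory.EllipticCurves.Kato2004.EulerSystemValues
open Summit.BirchSwinnertonDyer.Rank1Residual.GaloisImage
open Summit.BirchSwinnertonDyer.Rank1Residual.Additive
open Summit.BirchSwinnertonDyer.Rank1Residual.Additive.LocalLog
open Summit.BirchSwinnertonDyer.BirchSwinnertonDyer.Theses.KimAtThreeKolyvagin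
open Summit.BirchSwinnertonDyer.BirchSwinnertonDyer.Theorems.KimAtThreeKolyvaginDefs
open Summit.BirchSwinnertonDyer.BirchSwinnertonDyer.Theorems.KimAtThreeDeepLowerExpStarOmega
open Summit.BirchSwinnertonDyer.BirchSwinnertonDyer.Theorems.KimAtThreeDeepLowerExpStarOmegaPlace
open Summit.BirchSwinnertonDyer.BirchSwinnertonDyer.Theorems.KimAtThreeDeepLowerExpStarOmegaBridge
open Summit.BirchSwinnertonDyer.BirchSwinnertonDyer.Theorems.KimAtThreeDeepLowerExpStarOmegaItem
open Summit.BirchSwinnertonDyer.BirchSwinnertonDyer.Theorems.KimAtThreeDeepUpperExpStarFacts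

namespace Summit.BirchSwinnertonDyer.BirchSwinnertonDyer.Theorems.KimAtThreeDeepUpperDefinedKatoOfFacts

attribute [local instance 100000] NumberField.Place.instAlgebraCompletion
attribute [local instance] valuativeRelPlace topologicalSpacePlace isNonarchimedeanLocalField_place
  charZero_place padicAlgebraPlace fact_not_isUnit_place isAdicComplete_place

section KatoSide

variable
  -- the four cite facts of `Literature/NumberTheory/PAdicHodge/DualExpElliptic.lean`
  (hP : cupLogInjective_and_hasDualExp_of_isDeRham) (hDR : isDeRham_restrictedRationalTateRep)
  (hS : expStarCoord_eq_zero_iff_kummer) (hT : exists_smul_range_expStarCoord_iff_trace_log)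
  -- the KATO SIDE: (C1_ω) minus its `exp*`-clauses, for every line datum and binders
  (hKato : ∀ (W : WeierstrassCurve ℚ) [W.IsElliptic] [W.IsGloballyMinimal]
        [ContinuousSMul ℤ_[3] (W.tateModule 3)] [Module.Free ℤ_[3] (W.tateModule 3)]
        [Module.Finite ℤ_[3] (W.tateModule 3)],
        (∀ m : ℕ, W.HasSurjectiveModNGaloisRep (3 ^ m : ℕ)) →
        ∀ (v₃ : HeightOneSpectrum (𝓞 ℚ)) (hv₃ : ((3 : ℕ) : 𝓞 ℚ) ∈ v₃.asIdeal),
        ∀ {N : ℕ} [NeZero N] (P : ModularParametrizationData W N), N = W.conductorNorm ℤ →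
          (∀ z ∈ P.L.lattice, ∃ w ∈ periodLattice P.f, z = P.c * w) →
          (haveI : Fact (((3 : ℕ) : 𝓞 ℚ) ∈ v₃.asIdeal) := ⟨hv₃⟩
          ∀ d : LocalNeronLineAt W 3 v₃,
          ∀ (hinj : (bdRPeriodRingData (valuation_place_lt_one 3 v₃)).CupLogInjective (logCyclotomic 3)
              (localRationalTateRep W 3 (galRestrictPlace v₃)))
            (hex : ∀ z : contOneCocycles (localRationalTateRep W 3 (galRestrictPlace v₃)).toTopRep,
              (bdRPeriodRingData (valuation_place_lt_one 3 v₃)).HasDualExp (logCyclotomic 3)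
                (localRationalTateRep W 3 (galRestrictPlace v₃)) fun σ => z.1 σ)
            (ιp : Place.Completion (Sum.inr v₃ : Place ℚ) →+* ℚ_[3])
            (e : Place.Completion (Sum.inr v₃ : Place ℚ)) (he : e ≠ 0),
          ∃ (ι : (n : ℕ) → (CyclotomicField n ℚ →+* ℂ)) (κK : ℝ)
            (Λ : ∀ (k' : ℕ) (r : Finset (HeightOneSpectrum (𝓞 ℚ))),
              H1 (tateRep W 3) (cycSubgroup 3 k' r) →ₗ[ℤ_[3]] ℚ_[3] ⊗[ℚ] CyclotomicField (cycLevel 3 k' r) ℚ),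
            κK ≠ 0 ∧
            -- (X1-int_b): `Λ_{0,r}` agrees with `φ` modulo `3^{j+1-b}·L_int` on restriction-compatible classes
            (∃ b : ℕ, ∀ (j : ℕ) (r : Finset (HeightOneSpectrum (𝓞 ℚ)))
              (Ψ : H1 (tateRep W 3) (cycSubgroup 3 0 r) →+
                continuousCohomology 1 (subgroupRep
                  (W.torsionGaloisModule (((3 : ℕ) : ℤ) ^ j * ((3 : ℕ) : ℤ))).toTopRep (cycSubgroup 3 0 r))),
              (∀ (φ₁ : contOneCocycles (subgroupRep (tateRep W 3).toTopRep (cycSubgroup 3 0 r)))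
                  (ψ : contOneCocycles (subgroupRep
                    (W.torsionGaloisModule (((3 : ℕ) : ℤ) ^ j * ((3 : ℕ) : ℤ))).toTopRep (cycSubgroup 3 0 r))),
                  (∀ g, ((ψ.1 g : geomTorsion W (((3 : ℕ) : ℤ) ^ j * ((3 : ℕ) : ℤ))) : geomPoints W) =
                    TateModule.proj 3 (j + 1) (φ₁.1 g)) →
                  Ψ (oneCocycleClass _ φ₁) = oneCocycleClass _ ψ) →
              ∀ (y : H1 (tateRep W 3) (cycSubgroup 3 0 r))
                (κ₀ : galoisCohomology (W.torsionGaloisModule (((3 : ℕ) : ℤ) ^ j * ((3 : ℕ) : ℤ))) 1)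
                (h : (tateLocalRep W 3 (Sum.inr v₃)).cohomology 1),
                resSubgroup (W.torsionGaloisModule (((3 : ℕ) : ℤ) ^ j * ((3 : ℕ) : ℤ))).toTopRep
                    (cycSubgroup 3 0 r) 1 κ₀ = Ψ y →
                galoisCohomology.localization (W.torsionGaloisModule (((3 : ℕ) : ℤ) ^ j * ((3 : ℕ) : ℤ)))
                    (Sum.inr v₃) 1 κ₀ = tateLocalMap W 3 j (Sum.inr v₃) h →
                ∃ l ∈ cycIntLattice 3 (cycLevel 3 0 r),
                  (((3 : ℕ) : ℤ_[3]) ^ b) • ((expStarOmegaPadicAt (d.smul e he) hinj hex ιp h ⊗ₜ[ℚ] (1 : CyclotomicField (cycLevel 3 0 r) ℚ)) - Λ 0 r y) =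
                    (((3 : ℕ) : ℤ_[3]) ^ (j + 1)) • (l : _)) ∧
            -- Kato's Euler system with its values in the coordinate `Λ`
            ∀ (c d a : ℤ) (A : ℕ), 0 < A → Int.gcd c (6 * 3 * A) = 1 → Int.gcd d (6 * 3 * N) = 1 →
              ∃ (z : ∀ (k' : ℕ) (r : (cyclotomicLevelsRat 3 (badPlaces c d A N)).Ideals),
                    H1 (tateRep W 3) ((cyclotomicLevelsRat 3 (badPlaces c d A N)).level k' r.1))
                (x : ∀ (k' : ℕ) (r : (cyclotomicLevelsRat 3 (badPlaces c d A N)).Ideals),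
                    CyclotomicField (cycLevel 3 k' r.1) ℚ),
                ZetaBody W 3 P.f ι κK Λ c d a A z x))

include hP hDR hS hT hKato

/-- **(C1_ω) — w2-c2's `hω` VERBATIM — from the four cite facts and the Kato side**: the `exp*`-clauses
`hinj`/`hex`/`hker`/`hdual` come from `expStar_clauses_of_facts` (Kato Prop. 1.2.3, `V_pE` de Rham, (S5a), (S5b)),
the rest from `hKato` at the SAME `d hinj hex ιp e he`. [cite: Kato1993LNM1553, Ch. II Prop. 1.2.3, §1.2.4, Ex. 1.3.5 and Thm. 1.4.1]
[cite: BlochKato1990, Lemma 3.8.1, Prop. 3.8 and Example 3.11] [cite: Kato2004Asterisque, (8.1.3), §9.4, Thm. 9.7 and Ex. 13.3] -/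
theorem expStarOmegaPackage_of_facts_of_katoSide :
    ∀ (W : WeierstrassCurve ℚ) [W.IsElliptic] [W.IsGloballyMinimal]
        [ContinuousSMul ℤ_[3] (W.tateModule 3)] [Module.Free ℤ_[3] (W.tateModule 3)]
        [Module.Finite ℤ_[3] (W.tateModule 3)],
        (∀ m : ℕ, W.HasSurjectiveModNGaloisRep (3 ^ m : ℕ)) →
        ∀ (v₃ : HeightOneSpectrum (𝓞 ℚ)) (hv₃ : ((3 : ℕ) : 𝓞 ℚ) ∈ v₃.asIdeal),
        ∀ {N : ℕ} [NeZero N] (P : ModularParametrizationData W N), N = W.conductorNorm ℤ →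
          (∀ z ∈ P.L.lattice, ∃ w ∈ periodLattice P.f, z = P.c * w) →
          (haveI : Fact (((3 : ℕ) : 𝓞 ℚ) ∈ v₃.asIdeal) := ⟨hv₃⟩
          ∀ d : LocalNeronLineAt W 3 v₃,
          ∃ (hinj : (bdRPeriodRingData (valuation_place_lt_one 3 v₃)).CupLogInjective (logCyclotomic 3)
              (localRationalTateRep W 3 (galRestrictPlace v₃)))
            (hex : ∀ z : contOneCocycles (localRationalTateRep W 3 (galRestrictPlace v₃)).toTopRep,
              (bdRPeriodRingData (valuation_place_lt_one 3 v₃)).HasDualExp (logCyclotomic 3)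
                (localRationalTateRep W 3 (galRestrictPlace v₃)) fun σ => z.1 σ)
            (ιp : Place.Completion (Sum.inr v₃ : Place ℚ) →+* ℚ_[3])
            (e : Place.Completion (Sum.inr v₃ : Place ℚ)) (he : e ≠ 0)
            (ι : (n : ℕ) → (CyclotomicField n ℚ →+* ℂ)) (κK : ℝ)
            (Λ : ∀ (k' : ℕ) (r : Finset (HeightOneSpectrum (𝓞 ℚ))),
              H1 (tateRep W 3) (cycSubgroup 3 k' r) →ₗ[ℤ_[3]] ℚ_[3] ⊗[ℚ] CyclotomicField (cycLevel 3 k' r) ℚ),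
            κK ≠ 0 ∧
            -- hker: [BK90] Prop. 3.8 / Ex. 3.11 in lattice form (kernel of `exp*_ω` = `H¹_f = E(ℚ₃) ⊗ ℤ₃`)
            (∀ y, expStarOmegaPadicAt (d.smul e he) hinj hex ιp y = 0 ↔ ∀ j : ℕ, tateLocalMap W 3 j (Sum.inr v₃) y ∈
              W.kummerSelmerStructure (((3 : ℕ) : ℤ) ^ j * ((3 : ℕ) : ℤ)) (Sum.inr v₃)) ∧
            -- hdual: Tate local duality + [BK90] 3.8 in lattice form (`exp*_ω(H¹) = (log_ω E(ℚ₃))^∨`)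
            (∀ a : ℚ_[3], (∃ y, expStarOmegaPadicAt (d.smul e he) hinj hex ιp y = a) ↔
              ∀ Q : (W.baseChange ℚ_[3]).toAffine.Point, ‖a * padicLog (W.baseChange ℚ_[3]) Q‖ ≤ 1) ∧
            -- (X1-int_b): `Λ_{0,r}` agrees with `φ` modulo `3^{j+1-b}·L_int` on restriction-compatible classes
            (∃ b : ℕ, ∀ (j : ℕ) (r : Finset (HeightOneSpectrum (𝓞 ℚ)))
              (Ψ : H1 (tateRep W 3) (cycSubgroup 3 0 r) →+
                continuousCohomology 1 (subgroupRep
                  (W.torsionGaloisModule (((3 : ℕ) : ℤ) ^ j * ((3 : ℕ) : ℤ))).toTopRep (cycSubgroup 3 0 r))),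
              (∀ (φ₁ : contOneCocycles (subgroupRep (tateRep W 3).toTopRep (cycSubgroup 3 0 r)))
                  (ψ : contOneCocycles (subgroupRep
                    (W.torsionGaloisModule (((3 : ℕ) : ℤ) ^ j * ((3 : ℕ) : ℤ))).toTopRep (cycSubgroup 3 0 r))),
                  (∀ g, ((ψ.1 g : geomTorsion W (((3 : ℕ) : ℤ) ^ j * ((3 : ℕ) : ℤ))) : geomPoints W) =
                    TateModule.proj 3 (j + 1) (φ₁.1 g)) →
                  Ψ (oneCocycleClass _ φ₁) = oneCocycleClass _ ψ) →
              ∀ (y : H1 (tateRep W 3) (cycSubgroup 3 0 r))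
                (κ₀ : galoisCohomology (W.torsionGaloisModule (((3 : ℕ) : ℤ) ^ j * ((3 : ℕ) : ℤ))) 1)
                (h : (tateLocalRep W 3 (Sum.inr v₃)).cohomology 1),
                resSubgroup (W.torsionGaloisModule (((3 : ℕ) : ℤ) ^ j * ((3 : ℕ) : ℤ))).toTopRep
                    (cycSubgroup 3 0 r) 1 κ₀ = Ψ y →
                galoisCohomology.localization (W.torsionGaloisModule (((3 : ℕ) : ℤ) ^ j * ((3 : ℕ) : ℤ)))
                    (Sum.inr v₃) 1 κ₀ = tateLocalMap W 3 j (Sum.inr v₃) h →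
                ∃ l ∈ cycIntLattice 3 (cycLevel 3 0 r),
                  (((3 : ℕ) : ℤ_[3]) ^ b) • ((expStarOmegaPadicAt (d.smul e he) hinj hex ιp h ⊗ₜ[ℚ] (1 : CyclotomicField (cycLevel 3 0 r) ℚ)) - Λ 0 r y) =
                    (((3 : ℕ) : ℤ_[3]) ^ (j + 1)) • (l : _)) ∧
            -- Kato's Euler system with its values in the coordinate `Λ`
            ∀ (c d a : ℤ) (A : ℕ), 0 < A → Int.gcd c (6 * 3 * A) = 1 → Int.gcd d (6 * 3 * N) = 1 →
              ∃ (z : ∀ (k' : ℕ) (r : (cyclotomicLevelsRat 3 (badPlaces c d A N)).Ideals),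
                    H1 (tateRep W 3) ((cyclotomicLevelsRat 3 (badPlaces c d A N)).level k' r.1))
                (x : ∀ (k' : ℕ) (r : (cyclotomicLevelsRat 3 (badPlaces c d A N)).Ideals),
                    CyclotomicField (cycLevel 3 k' r.1) ℚ),
                ZetaBody W 3 P.f ι κK Λ c d a A z x) := by
  intro W _ _ _ _ _ htow v₃ hv₃ N _ P hN hlat d
  haveI : Fact (((3 : ℕ) : 𝓞 ℚ) ∈ v₃.asIdeal) := ⟨hv₃⟩
  obtain ⟨hinj, hex, ιp, e, he, hker, hdual⟩ := expStar_clauses_of_facts W 3 v₃ hP hDR hS hT d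
  obtain ⟨ι, κK, Λ, hκ0, hX1, hZ⟩ := hKato W htow v₃ hv₃ P hN hlat d hinj hex ιp e he
  exact ⟨hinj, hex, ιp, e, he, ι, κK, Λ, hκ0, hker, hdual, hX1, hZ⟩

-- Item `DefinedKatoUniformThree` (stmt-BirchSwinnertonDyer-20013) BY NAME from the facts and the Kato side is the term
-- `definedKatoUniformThree_of_expStarOmega (expStarOmegaPackage_of_facts_of_katoSide hP hDR hS hT hKato) hND`
-- (w2-c2's `KimAtThreeDeepLowerExpStarOmegaItem`); it is not restated here (one name, one module).

/-- **Crux `DeepUpperAtThree` (stmt-BirchSwinnertonDyer-19076) BY NAME** from the four cite-only leaves,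
`nonempty_neronDeRhamDatum`, the four `exp*` cite facts and the Kato side. Conditional; nothing is booked.
[cite: Kim2025RefinedTNC, Thm 1.1] [cite: Sakamoto2024, Thm. 4.4 (1)(2) (p. 926)] [cite: MazurRubin2004, Thm. 5.2.12 and App. A Prop. A.2] -/
theorem deepUpperAtThree_of_leaves_of_facts_of_katoSide (hND : nonempty_neronDeRhamDatum)
    (hSak : SakamotoKolyvaginThree) (hGZK : RankEqAnalyticRankLeOne) (hPT : PoitouTateSelmerDuality)
    (hlev : CarayolLevelEqConductor) :
    Summit.BirchSwinnertonDyer.BirchSwinnertonDyer.Theses.KimAtThreeKolyvagin.DeepUpperAtThree :=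
  (deepLower_and_deepUpper_of_definedKatoUniformThree
    (definedKatoUniformThree_of_expStarOmega
      (expStarOmegaPackage_of_facts_of_katoSide hP hDR hS hT hKato) hND) hSak hGZK hPT hlev).2

/-- **The whole W2 deep leaf `N11.KimAtThreeDeepPUB`** from the four cite-only leaves, `nonempty_neronDeRhamDatum`,
the four `exp*` cite facts and the Kato side. Conditional; nothing is booked.
[cite: Kim2025RefinedTNC, Thm 1.1 and Thm 1.2] [cite: Sakamoto2024, Thm. 4.4] [cite: MazurRubin2004, Thm. 5.2.12] -/
theorem kimAtThreeDeepPUB_of_leaves_of_facts_of_katoSide (hND : nonempty_neronDeRhamDatum) :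
    SakamotoKolyvaginThree ∧ RankEqAnalyticRankLeOne ∧ PoitouTateSelmerDuality ∧ CarayolLevelEqConductor →
      Summit.BirchSwinnertonDyer.Rank1Residual.Additive.N11.KimAtThreeDeepPUB :=
  kimAtThreeDeepPUB_of_definedKatoUniformThree
    (definedKatoUniformThree_of_expStarOmega
      (expStarOmegaPackage_of_facts_of_katoSide hP hDR hS hT hKato) hND)

end KatoSide

end Summit.BirchSwinnertonDyer.BirchSwinnertonDyer.Theorems.KimAtThreeDeepUpperDefinedKatoOfFacts

end
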